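import Summits.ValiantsHypothesis.ValiantsHypothesis.Theses.SymmetroidDescartes

/-!
# Strategist sketch — crux `DerivedPencilRolleQuasi` (stmt-ValiantsHypothesis-18064)

Typed statements quoted in the seat-s1 addendum of `STRATEGY-CENSUS.md` (planner-cstrat-stmt-ValiantsHypothesis-18064-s1-0,
2026-08-17).  Everything here elaborates; the implications are proved.  The line registered by this seat lives in
`Lines/imm-halving.lean`; seat 0's typed statements live in its `StrategySketch.lean` (same crux directory, namespace
`…Strategy`; this file uses `…StrategyS1` to avoid clashes).
-/

set_option linter.dupNamespace false
set_option linter.unusedVariables false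

namespace Summit.ValiantsHypothesis.ValiantsHypothesis.Cruxes.DerivedPencilRolleQuasi.StrategyS1

open Polynomial Matrix Finset
open scoped BigOperators
open Summit.ValiantsHypothesis.ValiantsHypothesis.Theses.SymmetroidDescartes (DerivedPencilRolleQuasi)

/-- `Z₊` of a real polynomial. -/
noncomputable def posRoots (p : ℝ[X]) : ℕ := (p.roots.toFinset.filter (fun t => 0 < t)).card

/-- The crux's budget. -/
def budget (A m K : ℕ) : ℕ := (K + 1) ^ (A * K) * 2 ^ (Nat.log 2 m + 2) ^ A

/-- **S⁰ (strengthen, `C = 0`).** The crux WITHOUT the Rolle term: an absolute quasi bound for symmetric invertible-coefficient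
lacunary pencils.  Equivalent to the crux up to constants on paper (Disproof §A: the Rolle term is idle on the universal
triangular class), trivially implies it. -/
def QuasiRootBound : Prop :=
  ∃ A : ℕ, ∀ (m K : ℕ) (S : Fin (K + 1) → Matrix (Fin m) (Fin m) ℝ) (d : Fin (K + 1) → ℕ),
    (∀ l, (S l).IsSymm) → (∀ l, (S l).det ≠ 0) → StrictMono d →
      posRoots (∑ l, (X : ℝ[X]) ^ d l • (S l).map Polynomial.C).det ≤ budget A m K

/-- **S¹ (strengthen further: drop symmetry and invertibility).** General square lacunary pencils.  Still equivalent to the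
crux up to constants on paper (Hessenberg/ABP universality `det_hessDet` + Mahajan–Vinay), trivially implies it. -/
def GeneralPencilQuasiBound : Prop :=
  ∃ A : ℕ, ∀ (m K : ℕ) (T : Fin (K + 1) → Matrix (Fin m) (Fin m) ℝ) (d : Fin (K + 1) → ℕ), StrictMono d →
      posRoots (∑ l, (X : ℝ[X]) ^ d l • (T l).map Polynomial.C).det ≤ budget A m K

/-- **S² (the bilinear law, sibling census S5 transported) — DEAD ON PAPER.** `log Z = O(log m · log K)` for all symmetric
pencils.  Refuted by the formalised staircase family with `L = ⌊log₂ n⌋` levels (`K = L+2` terms, `m ≤ 2^{12}n^{12}`,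
`Z = n^L − 1`): `log Z = log² n ≫ a(12 log n + 13)(log log n + 3)` — seat-0 census F2 (exponent binarisation kills every
`(log m)(log K)` law).  Kept typed as a negative edge; the would-be line `bmd-transfer` through its semidefinite avatar BMD was
built (rc 0) and WITHDRAWN before registration for this reason. -/
def BilinearMatrixDescartes : Prop :=
  ∃ a : ℕ, ∀ (m K : ℕ) (S : Fin (K + 1) → Matrix (Fin m) (Fin m) ℝ) (d : Fin (K + 1) → ℕ), (∀ l, (S l).IsSymm) →
      posRoots (∑ l, (X : ℝ[X]) ^ d l • (S l).map Polynomial.C).det ≤ 2 ^ (a * (Nat.log 2 m + 1) * (Nat.log 2 (K + 1) + 1))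

/-- **D (regime decomposition; NOT filed).**  The crux restricted to the content regime `(log₂ m + 2)^{A-1} < K`, the only
place where it says more than the Descartes monomial count; the complementary piece is Descartes.  The restricted piece is the
whole crux (the route's regime `log₂ m ≈ c log² K` lies inside), so this split is recorded, not filed. -/
def ContentRegimeBound : Prop :=
  ∃ A : ℕ, ∀ (m K : ℕ) (S : Fin (K + 1) → Matrix (Fin m) (Fin m) ℝ) (d : Fin (K + 1) → ℕ),
    (∀ l, (S l).IsSymm) → (∀ l, (S l).det ≠ 0) → StrictMono d → (Nat.log 2 m + 2) ^ (A - 1) < K →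
      posRoots (∑ l, (X : ℝ[X]) ^ d l • (S l).map Polynomial.C).det ≤ budget A m K

/-- **N (negation target, typed).**  What a counterexample must be, for EVERY `A`: by Disproof §A it may be sought in the
triangular (ABP) class, where the Rolle term vanishes; at `A = 1` the staircase family is one on paper (census §Negation);
at `A = 2` every path-dominance-certified family is excluded (pieces of the path envelope `≤ (K+1)(2k)^{⌈log₂ k⌉} < B_2(2k,K)`). -/
def QuasiCounterexample (A : ℕ) : Prop :=
  ∀ C₀ : ℕ, ∃ (m K : ℕ) (S : Fin (K + 1) → Matrix (Fin m) (Fin m) ℝ) (d : Fin (K + 1) → ℕ),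
    (∀ l, (S l).IsSymm) ∧ (∀ l, (S l).det ≠ 0) ∧ StrictMono d ∧
      C₀ * posRoots (∑ l : Fin K, (X : ℝ[X]) ^ (d l.succ - d 0 - 1) •
          (((d l.succ - d 0 : ℕ) : ℝ) • S l.succ).map Polynomial.C).det
        + budget A m K < posRoots (∑ l, (X : ℝ[X]) ^ d l • (S l).map Polynomial.C).det

theorem not_crux_iff : ¬ DerivedPencilRolleQuasi ↔ ∀ A, QuasiCounterexample A := by
  unfold DerivedPencilRolleQuasi QuasiCounterexample budget posRoots
  push Not
  constructor
  · intro h A C₀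
    obtain ⟨m, K, S, d, h1, h2, h3, h4⟩ := h C₀ A
    exact ⟨m, K, S, d, h1, h2, h3, h4⟩
  · intro h C₀ A
    obtain ⟨m, K, S, d, h1, h2, h3, h4⟩ := h A C₀
    exact ⟨m, K, S, d, h1, h2, h3, h4⟩

theorem crux_of_quasiRootBound (h : QuasiRootBound) : DerivedPencilRolleQuasi := by
  obtain ⟨A, hA⟩ := h
  refine ⟨0, A, fun m K S d hS hdet hd => ?_⟩
  rw [zero_mul, zero_add]
  exact hA m K S d hS hdet hd

theorem quasiRootBound_of_general (h : GeneralPencilQuasiBound) : QuasiRootBound := by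
  obtain ⟨A, hA⟩ := h
  exact ⟨A, fun m K S d _ _ hd => hA m K S d hd⟩

theorem crux_of_general (h : GeneralPencilQuasiBound) : DerivedPencilRolleQuasi :=
  crux_of_quasiRootBound (quasiRootBound_of_general h)

end Summit.ValiantsHypothesis.ValiantsHypothesis.Cruxes.DerivedPencilRolleQuasi.StrategyS1
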